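import Mathlib
import Summits.Ventures.HodgeRepro.Tier4.Target
import Summits.Ventures.HodgeRepro.Tier4.Common.TargetBall
import Summits.Ventures.HodgeRepro.Tier4.Common.AutForms
import Summits.Ventures.HodgeRepro.Tier4.Line3.KMDatum
import Summits.Ventures.HodgeRepro.Tier4.Line3.KMDatumS
import Summits.Ventures.HodgeRepro.Tier4.Line3.KernelBounds
import Summits.Ventures.HodgeRepro.Tier4.Line3.KernelIntegralPos

/-!
# Tier4/Line3/KernelIntegralPosS — L3.7 for the SESQUILINEAR datum (v0.14 shape): archimedean positivity

Blind re-derivation cell `pub-hodge-repro`, Tier 4 «PROVE THE STEP» (README §9–§10), LINE L3 (skeleton FILED v0.14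
5b774b9a… L864 `kernel_integral_pos`, lead S12401), seat t4-L3-p1 (prover).  The interface change v0.13 → v0.14 made the
datum sesquilinear (`KMDatumS` / `datumS`, `Tier4/Line3/KMDatumS.lean`); the landed `Tier4/Line3/KernelIntegralPos.lean`
(p663124) proves L3.7 for the superseded conjugate-linear `datum` and no longer closes the skeleton's statement.  This
module re-proves it for `datumS`, REUSING every datum-independent lemma of `KernelBounds` / `KernelIntegralPos`
(the sphere lemma, the uniform bound `exists_pos_le_phi_add`, `continuousOn_maj`, `maj_add_maj`,
`exists_bound_rpow_exp`, `isCompact_nsq_le`, `volume_ball_ne_top`) and replacing the four datum-specific facts: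
continuity of `ȳ ⬝ A_k(z) y` in `z`, the bound `‖ȳ ⬝ A y‖ ≤ (Σ_i ‖y i‖)² · max ‖A i j‖`, `‖datumS‖`, and the
annulus bound (`(Σ‖y i‖)²` in place of `Σ‖y i‖`).

MAIN THEOREM `kernel_integral_pos_of_coordsS`: for `ya, yb ∈ ℂ³` spanning a `J`-positive plane (`hpos`) and a datum
`Φ : KMDatumS` with `wedge (datumS Φ ya z₀) (datumS Φ yb z₀) ≠ 0` for some `z₀ ∈ ball` (`hab`), the function
`wedge · conj wedge` is integrable on the ball and its integral has positive real part.  The skeleton's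
`T4Data.kernel_integral_pos` (v0.14 L864, stated over `datumS` once the names are adopted) is the instance
`ya := X.ballCoord a`, `yb := X.ballCoord b`.

Nothing here asserts anything about the truth of (P); HC_CM is NOT proved by anyone in this repository.
-/

set_option autoImplicit false

noncomputable section

namespace Summit.Ventures.HodgeRepro.Tier4.Line3

open Summit.Ventures.HodgeRepro.Tier4
open Matrix MeasureTheory
open scoped ComplexConjugate

/-! ## 1. Continuity and bounds of the sesquilinear datum -/

section DatumS

variable (Φ : KMDatumS)

/-- `z ↦ ȳ ⬝ A_k(z) y` is continuous on the ball. -/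
theorem continuousOn_sesq (y : Fin 3 → ℂ) (k : Fin 2) :
    ContinuousOn (fun z => star y ⬝ᵥ (Φ.A z k *ᵥ y)) ball := by
  simp only [dotProduct, Matrix.mulVec]
  refine continuousOn_finsetSum _ fun i _ => continuousOn_const.mul ?_
  exact continuousOn_finsetSum _ fun j _ => (Φ.cont k i j).mul continuousOn_const

/-- `datumS Φ y · k` is continuous on the ball. -/
theorem continuousOn_datumS (y : Fin 3 → ℂ) (k : Fin 2) :
    ContinuousOn (fun z => datumS Φ y z k) ball := by
  unfold datumS
  exact (continuousOn_sesq Φ y k).mul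
    (Complex.continuous_ofReal.comp_continuousOn
      (Real.continuous_exp.comp_continuousOn (continuousOn_const.mul (continuousOn_maj y))))

/-- The wedge `Φ(ya, z) ∧ Φ(yb, z)` is continuous on the ball. -/
theorem continuousOn_wedge_datumS (ya yb : Fin 3 → ℂ) :
    ContinuousOn (fun z => wedge (datumS Φ ya z) (datumS Φ yb z)) ball := by
  unfold wedge
  exact ((continuousOn_datumS Φ ya 0).mul (continuousOn_datumS Φ yb 1)).sub
    ((continuousOn_datumS Φ ya 1).mul (continuousOn_datumS Φ yb 0))

/-- `‖ȳ ⬝ A y‖ ≤ (Σ_i ‖y i‖)² · M` when every `‖A i j‖ ≤ M`. -/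
theorem norm_sesq_le (y : Fin 3 → ℂ) (A : Matrix (Fin 3) (Fin 3) ℂ) (M : ℝ) (hA : ∀ i j, ‖A i j‖ ≤ M) :
    ‖star y ⬝ᵥ (A *ᵥ y)‖ ≤ (∑ i, ‖y i‖) ^ 2 * M := by
  have hrow : ∀ i, ‖(A *ᵥ y) i‖ ≤ (∑ j, ‖y j‖) * M := by
    intro i
    calc ‖(A *ᵥ y) i‖ = ‖∑ j, A i j * y j‖ := rfl
      _ ≤ ∑ j, ‖A i j * y j‖ := norm_sum_le _ _
      _ = ∑ j, ‖A i j‖ * ‖y j‖ := by simp only [norm_mul]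
      _ ≤ ∑ j, M * ‖y j‖ := Finset.sum_le_sum fun j _ => mul_le_mul_of_nonneg_right (hA i j) (norm_nonneg _)
      _ = (∑ j, ‖y j‖) * M := by rw [← Finset.mul_sum, mul_comm]
  calc ‖star y ⬝ᵥ (A *ᵥ y)‖ ≤ (∑ i, ‖y i‖) * ((∑ j, ‖y j‖) * M) := norm_star_dotProduct_le y _ _ hrow
    _ = (∑ i, ‖y i‖) ^ 2 * M := by ring

/-- The norm of the datum: `‖datumS Φ y z k‖ = ‖ȳ ⬝ A_k(z) y‖ · exp(−π maj y z)`. -/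
theorem norm_datumS (y : Fin 3 → ℂ) (z : Fin 2 → ℂ) (k : Fin 2) :
    ‖datumS Φ y z k‖ = ‖star y ⬝ᵥ (Φ.A z k *ᵥ y)‖ * Real.exp (-Real.pi * maj y z) := by
  unfold datumS
  rw [norm_mul, Complex.norm_real, Real.norm_eq_abs, abs_of_pos (Real.exp_pos _)]

/-- `C ≥ 0` in any growth bound (the bound at `z = 0`). -/
theorem growth_const_nonnegS {C m : ℝ}
    (hC : ∀ z ∈ ball, ∀ k i j, ‖Φ.A z k i j‖ ≤ C / (1 - nsq z) ^ m) : 0 ≤ C := by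
  have h0 : (0 : Fin 2 → ℂ) ∈ ball := by simp [ball, nsq]
  have := hC 0 h0 0 0 0
  have hn : nsq (0 : Fin 2 → ℂ) = 0 := by simp [nsq]
  rw [hn, sub_zero, Real.one_rpow, div_one] at this
  exact (norm_nonneg _).trans this

end DatumS

/-! ## 2. The wedge is bounded on the ball -/

section MainBoundsS

variable (Φ : KMDatumS) (ya yb : Fin 3 → ℂ)

/-- **BOUND ON THE ANNULUS** `1 − nsq z ≤ c/2` (where `φ ≥ c/2`): the Gaussian of the majorant beats the polynomial
growth of the sesquilinear datum. -/
theorem exists_bound_wedge_annulusS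
    (hpos : ∀ u v : ℂ, (u ≠ 0 ∨ v ≠ 0) → 0 < quadJ (u • ya + v • yb)) :
    ∃ c M : ℝ, 0 < c ∧ ∀ z ∈ ball, 1 - nsq z ≤ c / 2 →
      ‖wedge (datumS Φ ya z) (datumS Φ yb z)‖ ≤ M := by
  obtain ⟨c, hc, hφ⟩ := exists_pos_le_phi_add ya yb hpos
  obtain ⟨C, m, hC⟩ := Φ.growth
  have hC0 : 0 ≤ C := growth_const_nonnegS Φ hC
  obtain ⟨M₀, hM₀, hbnd⟩ := exists_bound_rpow_exp m (Real.pi * c) (by positivity)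
  refine ⟨c, 2 * ((∑ i, ‖ya i‖) ^ 2 * (∑ i, ‖yb i‖) ^ 2) * (C ^ 2 * M₀) *
    Real.exp (-Real.pi * (quadJ ya + quadJ yb)), hc, ?_⟩
  intro z hz hann
  have hs0 : 0 < 1 - nsq z := sub_pos.mpr hz
  have hs1 : 1 - nsq z ≤ 1 := by
    have : 0 ≤ nsq z := add_nonneg (sq_nonneg _) (sq_nonneg _)
    linarith
  have hsm : 0 < (1 - nsq z) ^ m := Real.rpow_pos_of_pos hs0 m
  have hB0 : 0 ≤ C / (1 - nsq z) ^ m := div_nonneg hC0 hsm.le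
  have hdot : ∀ (y : Fin 3 → ℂ) (k : Fin 2),
      ‖star y ⬝ᵥ (Φ.A z k *ᵥ y)‖ ≤ (∑ i, ‖y i‖) ^ 2 * (C / (1 - nsq z) ^ m) :=
    fun y k => norm_sesq_le y _ _ (fun i j => hC z hz k i j)
  have hd : ∀ (y : Fin 3 → ℂ) (k : Fin 2),
      ‖datumS Φ y z k‖ ≤ (∑ i, ‖y i‖) ^ 2 * (C / (1 - nsq z) ^ m) * Real.exp (-Real.pi * maj y z) := by
    intro y k
    rw [norm_datumS]
    exact mul_le_mul_of_nonneg_right (hdot y k) (Real.exp_pos _).le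
  have hw : ‖wedge (datumS Φ ya z) (datumS Φ yb z)‖ ≤
      2 * ((∑ i, ‖ya i‖) ^ 2 * (∑ i, ‖yb i‖) ^ 2) * (C / (1 - nsq z) ^ m) ^ 2 *
        (Real.exp (-Real.pi * maj ya z) * Real.exp (-Real.pi * maj yb z)) := by
    unfold wedge
    calc ‖datumS Φ ya z 0 * datumS Φ yb z 1 - datumS Φ ya z 1 * datumS Φ yb z 0‖
        ≤ ‖datumS Φ ya z 0 * datumS Φ yb z 1‖ + ‖datumS Φ ya z 1 * datumS Φ yb z 0‖ := norm_sub_le _ _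
      _ = ‖datumS Φ ya z 0‖ * ‖datumS Φ yb z 1‖ + ‖datumS Φ ya z 1‖ * ‖datumS Φ yb z 0‖ := by
          rw [norm_mul, norm_mul]
      _ ≤ ((∑ i, ‖ya i‖) ^ 2 * (C / (1 - nsq z) ^ m) * Real.exp (-Real.pi * maj ya z)) *
            ((∑ i, ‖yb i‖) ^ 2 * (C / (1 - nsq z) ^ m) * Real.exp (-Real.pi * maj yb z)) +
          ((∑ i, ‖ya i‖) ^ 2 * (C / (1 - nsq z) ^ m) * Real.exp (-Real.pi * maj ya z)) *
            ((∑ i, ‖yb i‖) ^ 2 * (C / (1 - nsq z) ^ m) * Real.exp (-Real.pi * maj yb z)) := by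
          gcongr
          · exact hd ya 0
          · exact hd yb 1
          · exact hd ya 1
          · exact hd yb 0
      _ = 2 * ((∑ i, ‖ya i‖) ^ 2 * (∑ i, ‖yb i‖) ^ 2) * (C / (1 - nsq z) ^ m) ^ 2 *
            (Real.exp (-Real.pi * maj ya z) * Real.exp (-Real.pi * maj yb z)) := by ring
  have hφz : c / 2 ≤ (‖star (lift3 z) ⬝ᵥ (J *ᵥ ya)‖ ^ 2 + ‖star (lift3 z) ⬝ᵥ (J *ᵥ yb)‖ ^ 2) := by
    have := hφ z hz.le
    linarith
  have hexp : Real.exp (-Real.pi * maj ya z) * Real.exp (-Real.pi * maj yb z) ≤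
      Real.exp (-Real.pi * (quadJ ya + quadJ yb)) * Real.exp (-(Real.pi * c / (1 - nsq z))) := by
    rw [← Real.exp_add, ← Real.exp_add, Real.exp_le_exp]
    have key : Real.pi * c / (1 - nsq z) ≤
        Real.pi * (2 * (‖star (lift3 z) ⬝ᵥ (J *ᵥ ya)‖ ^ 2 + ‖star (lift3 z) ⬝ᵥ (J *ᵥ yb)‖ ^ 2) /
          (1 - nsq z)) := by
      rw [mul_div_assoc]
      refine mul_le_mul_of_nonneg_left ?_ Real.pi_pos.le
      rw [div_le_div_iff_of_pos_right hs0]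
      linarith
    have hsum := maj_add_maj ya yb z
    calc -Real.pi * maj ya z + -Real.pi * maj yb z
        = -Real.pi * (maj ya z + maj yb z) := by ring
      _ = -Real.pi * (quadJ ya + quadJ yb +
            2 * (‖star (lift3 z) ⬝ᵥ (J *ᵥ ya)‖ ^ 2 + ‖star (lift3 z) ⬝ᵥ (J *ᵥ yb)‖ ^ 2) /
              (1 - nsq z)) := by rw [hsum]
      _ = -Real.pi * (quadJ ya + quadJ yb) -
            Real.pi * (2 * (‖star (lift3 z) ⬝ᵥ (J *ᵥ ya)‖ ^ 2 + ‖star (lift3 z) ⬝ᵥ (J *ᵥ yb)‖ ^ 2) /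
              (1 - nsq z)) := by ring
      _ ≤ -Real.pi * (quadJ ya + quadJ yb) - Real.pi * c / (1 - nsq z) := sub_le_sub_left key _
      _ = -Real.pi * (quadJ ya + quadJ yb) + -(Real.pi * c / (1 - nsq z)) := by ring
  have hBE : (C / (1 - nsq z) ^ m) ^ 2 * Real.exp (-(Real.pi * c / (1 - nsq z))) ≤ C ^ 2 * M₀ := by
    have h := hbnd (1 - nsq z) hs0 hs1
    calc (C / (1 - nsq z) ^ m) ^ 2 * Real.exp (-(Real.pi * c / (1 - nsq z)))
        = C ^ 2 * ((1 / (1 - nsq z) ^ m) ^ 2 * Real.exp (-(Real.pi * c / (1 - nsq z)))) := by ring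
      _ ≤ C ^ 2 * M₀ := by gcongr
  have hSa : 0 ≤ (∑ i, ‖ya i‖) ^ 2 := sq_nonneg _
  have hSb : 0 ≤ (∑ i, ‖yb i‖) ^ 2 := sq_nonneg _
  calc ‖wedge (datumS Φ ya z) (datumS Φ yb z)‖
      ≤ 2 * ((∑ i, ‖ya i‖) ^ 2 * (∑ i, ‖yb i‖) ^ 2) * (C / (1 - nsq z) ^ m) ^ 2 *
          (Real.exp (-Real.pi * maj ya z) * Real.exp (-Real.pi * maj yb z)) := hw
    _ ≤ 2 * ((∑ i, ‖ya i‖) ^ 2 * (∑ i, ‖yb i‖) ^ 2) * (C / (1 - nsq z) ^ m) ^ 2 *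
          (Real.exp (-Real.pi * (quadJ ya + quadJ yb)) * Real.exp (-(Real.pi * c / (1 - nsq z)))) := by
        gcongr
    _ = 2 * ((∑ i, ‖ya i‖) ^ 2 * (∑ i, ‖yb i‖) ^ 2) *
          ((C / (1 - nsq z) ^ m) ^ 2 * Real.exp (-(Real.pi * c / (1 - nsq z)))) *
          Real.exp (-Real.pi * (quadJ ya + quadJ yb)) := by ring
    _ ≤ 2 * ((∑ i, ‖ya i‖) ^ 2 * (∑ i, ‖yb i‖) ^ 2) * (C ^ 2 * M₀) *
          Real.exp (-Real.pi * (quadJ ya + quadJ yb)) := by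
        gcongr

/-- **THE WEDGE IS BOUNDED ON THE BALL**. -/
theorem exists_bound_wedge_ballS
    (hpos : ∀ u v : ℂ, (u ≠ 0 ∨ v ≠ 0) → 0 < quadJ (u • ya + v • yb)) :
    ∃ M : ℝ, ∀ z ∈ ball, ‖wedge (datumS Φ ya z) (datumS Φ yb z)‖ ≤ M := by
  obtain ⟨c, M₁, hc, hM₁⟩ := exists_bound_wedge_annulusS Φ ya yb hpos
  have hsub : {z : Fin 2 → ℂ | nsq z ≤ 1 - c / 2} ⊆ ball := fun z hz => by
    simp only [Set.mem_setOf_eq] at hz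
    show nsq z < 1
    linarith
  obtain ⟨M₂, hM₂⟩ := (isCompact_nsq_le (1 - c / 2) (by linarith)).exists_bound_of_continuousOn
    ((continuousOn_wedge_datumS Φ ya yb).mono hsub)
  refine ⟨max M₁ M₂, fun z hz => ?_⟩
  by_cases h : nsq z ≤ 1 - c / 2
  · exact (hM₂ z h).trans (le_max_right _ _)
  · exact (hM₁ z hz (by have := not_le.mp h; linarith)).trans (le_max_left _ _)

end MainBoundsS

/-! ## 3. L3.7 for the sesquilinear datum -/

/-- **L3.7 ARCHIMEDEAN POSITIVITY, sesquilinear datum, over ball coordinates.** -/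
theorem kernel_integral_pos_of_coordsS (Φ : KMDatumS) (ya yb : Fin 3 → ℂ)
    (hab : ∃ z ∈ ball, wedge (datumS Φ ya z) (datumS Φ yb z) ≠ 0)
    (hpos : ∀ u v : ℂ, (u ≠ 0 ∨ v ≠ 0) →
      0 < (star (u • ya + v • yb) ⬝ᵥ (J *ᵥ (u • ya + v • yb))).re) :
    IntegrableOn (fun z => wedge (datumS Φ ya z) (datumS Φ yb z) *
        conj (wedge (datumS Φ ya z) (datumS Φ yb z))) ball ∧
      0 < (∫ z in ball, wedge (datumS Φ ya z) (datumS Φ yb z) *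
        conj (wedge (datumS Φ ya z) (datumS Φ yb z))).re := by
  have hpos' : ∀ u v : ℂ, (u ≠ 0 ∨ v ≠ 0) → 0 < quadJ (u • ya + v • yb) := fun u v h => by
    rw [← quadJ_eq_re]
    exact hpos u v h
  have hfg : (fun z => wedge (datumS Φ ya z) (datumS Φ yb z) * conj (wedge (datumS Φ ya z) (datumS Φ yb z))) =
      fun z => ((Complex.normSq (wedge (datumS Φ ya z) (datumS Φ yb z)) : ℝ) : ℂ) := by
    funext z
    rw [Complex.mul_conj]
  rw [hfg]
  have hwc : ContinuousOn (fun z => wedge (datumS Φ ya z) (datumS Φ yb z)) ball :=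
    continuousOn_wedge_datumS Φ ya yb
  have hgc : ContinuousOn (fun z => Complex.normSq (wedge (datumS Φ ya z) (datumS Φ yb z))) ball :=
    Complex.continuous_normSq.comp_continuousOn hwc
  have hmeas : MeasurableSet ball := isOpen_ball.measurableSet
  obtain ⟨M, hM⟩ := exists_bound_wedge_ballS Φ ya yb hpos'
  have hgint : IntegrableOn (fun z => Complex.normSq (wedge (datumS Φ ya z) (datumS Φ yb z))) ball := by
    refine ⟨hgc.aestronglyMeasurable hmeas, ?_⟩
    refine HasFiniteIntegral.restrict_of_bounded (M ^ 2) volume_ball_ne_top.lt_top ?_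
    refine (ae_restrict_mem hmeas).mono fun z hz => ?_
    rw [Real.norm_eq_abs, abs_of_nonneg (Complex.normSq_nonneg _), Complex.normSq_eq_norm_sq]
    exact pow_le_pow_left₀ (norm_nonneg _) (hM z hz) 2
  refine ⟨hgint.ofReal, ?_⟩
  rw [integral_complex_ofReal, Complex.ofReal_re]
  rw [setIntegral_pos_iff_support_of_nonneg_ae
    (Filter.Eventually.of_forall fun z => Complex.normSq_nonneg _) hgint]
  obtain ⟨z₀, hz₀, hne⟩ := hab
  have hg0 : Complex.normSq (wedge (datumS Φ ya z₀) (datumS Φ yb z₀)) ≠ 0 :=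
    (Complex.normSq_pos.mpr hne).ne'
  have hcont : ContinuousAt (fun z => Complex.normSq (wedge (datumS Φ ya z) (datumS Φ yb z))) z₀ :=
    hgc.continuousAt (isOpen_ball.mem_nhds hz₀)
  have hev : ∀ᶠ z in nhds z₀,
      Complex.normSq (wedge (datumS Φ ya z) (datumS Φ yb z)) ≠ 0 ∧ z ∈ ball :=
    (hcont.eventually_ne hg0).and (isOpen_ball.mem_nhds hz₀)
  obtain ⟨ε, hε, hball⟩ := Metric.eventually_nhds_iff.mp hev
  have hsub : Metric.ball z₀ ε ⊆
      Function.support (fun z => Complex.normSq (wedge (datumS Φ ya z) (datumS Φ yb z))) ∩ ball :=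
    fun z hz => ⟨(hball (Metric.mem_ball.mp hz)).1, (hball (Metric.mem_ball.mp hz)).2⟩
  exact lt_of_lt_of_le (Metric.measure_ball_pos volume z₀ hε) (measure_mono hsub)

end Summit.Ventures.HodgeRepro.Tier4.Line3

end
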